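import Summits.CriticalPhenomena.PercolationContinuityZ3.Theorems.PercNearOneGluingNoHeavyLowerTailAttachedChampionObserverExchange
import HarnessLib

/-!
# `NoHeavyLowerTail` (stmt-CriticalPhenomena-4575) — the ATTACHED SHIFT row and CIL for every observer with at most
# two gates (two hull ports), witness = the better gate

Support file (prover `prim-hp-4`, hull-port prover #4, LP-duality technique; `--supports stmt-CriticalPhenomena-4575`).
No definitions, no named facts, no sorries.

Notation of `…AttachedChampionObserverExchange.lean`: `μ = prodBernoulli w` on `Fin n`, relays `A`, level `j`,
`M_x = |{a ∈ A : x ↔ a}|`, observer `o` with `N = M_o`, `R_x = {M_x ≤ j}`, `L = {1 ≤ N ≤ j}`, `𝔸 = {1 ≤ N} = {o ↔ A}`.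

In the LP-duality analysis of the hull-port residual (memo `run/shared/lean/prim/prim-hp-4/HULLPORT-LP.md`) the dual
certificates of the m = 3 residual are carried, next to the champion rows, by instances of ONE row: the attached transfer
`T[x~b;c] : μ(x ↔ b, R_b) ≤ μ(x ↔ b, R_c)` (`observer_attached_sub_le`, for `μ(R_b) ≤ μ(R_c)`).  Splitting that row along
`{x ↔ c}` — where the two counts agree — gives its AVOIDING form, and the avoiding form settles two gates outright:

* `attached_avoid_shift` (**shift row**): for any vertices `o, b, c` with `μ(R_b) ≤ μ(R_c)`:
  `μ(o ↔ b, o ↮ c, N ≤ j) ≤ μ(o ↔ b, o ↮ c, M_c ≤ j)` — if the observer hangs on `b` and avoids the no-lonelier vertex `c`,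
  its block is light no more often than `c` is.
* `attached_le_of_twoGates` (**two gates, attached form**): if every connection `o ↔ a` (`a ∈ A`) passes, as an event, through
  `b` or `b'` (`{o ↔ a} ⊆ {o ↔ b} ∪ {o ↔ b'}`, e.g. the Steiner region of `o` has boundary relays `{b, b'}`) and
  `μ(R_{b'}) ≤ μ(R_b)`, then `μ(1 ≤ N ≤ j) ≤ μ(M_b ≤ j ∧ 1 ≤ N)`.  Proof: `L = ({o↔b} ∩ R_b) ⊔ ({o↔b'} ∩ {o↮b} ∩ {N ≤ j})`, shift
  the second piece to `R_b`.  NEITHER gate needs to be a champion (the tree's `attachedChampion_twoGate` needs the champion as a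
  gate; the two-boundary-relay case of XZ was so far a paper proof).
* `cil_of_twoGates` — hence the registered stub `stub_cumulativeIsolation` (CIL: `∃ a ∈ A, μ(L) ≤ μ(R_a)`) holds for every such
  observer, every level, every weighted graph: witness = the better gate.
For three or more gates the same chain leaves the defect `μ(o↔b₂, o↔b₃, o↮b₁, R_{b₁}) − μ(o↔b₂, o↔b₃, o↮b₁, N ≤ j)`
(observer glued to both worse ports, avoiding the best), which is where the champion rows enter (memo §2(d)).
-/

noncomputable section

namespace Summit.CriticalPhenomena.PercolationContinuityZ3.Theorems

open MeasureTheory Set Literature.Probability.LatticeModels Literature.Probability.Percolation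
open scoped Classical BigOperators

variable {n : ℕ}

namespace AttachedShift

open AttachedChampionObserverExchange

/-- On `{o ↔ b}` the observer's count is the count of `b`. -/
theorem card_eq_on_attached (A : Finset (Fin n)) {o b : Fin n} {ω : BondConfig (Fin n)}
    (h : ω ∈ (openConn o b : Set (BondConfig (Fin n)))) :
    (A.filter fun x => ω ∈ openConn o x).card = (A.filter fun x => ω ∈ openConn b x).card :=
  card_eq_of_reachable A h

/-- **Shift row.**  For vertices `o, b, c`, relays `A`, level `j` with `μ(M_b ≤ j) ≤ μ(M_c ≤ j)`:
`μ(o ↔ b, o ↮ c, N ≤ j) ≤ μ(o ↔ b, o ↮ c, M_c ≤ j)`.  From `observer_attached_sub_le` (BHK two-cluster exchange) by splitting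
`{o ↔ b}` along `{o ↔ c}`, on which `M_b = M_c`. -/
theorem attached_avoid_shift (w : Sym2 (Fin n) → unitInterval) (A : Finset (Fin n)) (o b c : Fin n) (j : ℕ)
    (hbc : (prodBernoulli w).real {ω : BondConfig (Fin n) | (A.filter fun x => ω ∈ openConn b x).card ≤ j} ≤
      (prodBernoulli w).real {ω : BondConfig (Fin n) | (A.filter fun x => ω ∈ openConn c x).card ≤ j}) :
    (prodBernoulli w).real ((openConn o b : Set (BondConfig (Fin n))) ∩ (openConn o c)ᶜ ∩
        {ω | (A.filter fun x => ω ∈ openConn o x).card ≤ j}) ≤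
      (prodBernoulli w).real ((openConn o b : Set (BondConfig (Fin n))) ∩ (openConn o c)ᶜ ∩
        {ω | (A.filter fun x => ω ∈ openConn c x).card ≤ j}) := by
  set μ := prodBernoulli w with hμ
  set E : Set (BondConfig (Fin n)) := openConn o b with hE
  set F : Set (BondConfig (Fin n)) := openConn o c with hF
  set Rb : Set (BondConfig (Fin n)) := {ω | (A.filter fun x => ω ∈ openConn b x).card ≤ j} with hRb
  set Rc : Set (BondConfig (Fin n)) := {ω | (A.filter fun x => ω ∈ openConn c x).card ≤ j} with hRc
  set Ro : Set (BondConfig (Fin n)) := {ω | (A.filter fun x => ω ∈ openConn o x).card ≤ j} with hRo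
  have hmeas : ∀ s : Set (BondConfig (Fin n)), MeasurableSet s := fun _ => MeasurableSet.of_discrete
  -- T[o~b;c] with zero deficiency
  have hT : μ.real (E ∩ Rb) ≤ μ.real (E ∩ Rc) := by
    have key := observer_attached_sub_le w A o b c j
    have hmax : max 0 (μ.real Rb - μ.real Rc) = 0 := max_eq_left (by linarith)
    rw [hmax] at key
    linarith
  -- split both sides along F
  have hsb : μ.real (E ∩ Rb) = μ.real ((E ∩ Rb) ∩ F) + μ.real ((E ∩ Rb) \ F) :=
    (measureReal_inter_add_sdiff (μ := μ) (s := E ∩ Rb) (t := F) (hmeas F)).symm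
  have hsc : μ.real (E ∩ Rc) = μ.real ((E ∩ Rc) ∩ F) + μ.real ((E ∩ Rc) \ F) :=
    (measureReal_inter_add_sdiff (μ := μ) (s := E ∩ Rc) (t := F) (hmeas F)).symm
  -- on `E ∩ F` (o ↔ b and o ↔ c): `M_b = M_c`
  have hEF : (E ∩ Rb) ∩ F = (E ∩ Rc) ∩ F := by
    ext ω
    simp only [mem_inter_iff, hRb, hRc, mem_setOf_eq]
    constructor
    · rintro ⟨⟨hωE, hω⟩, hωF⟩
      refine ⟨⟨hωE, ?_⟩, hωF⟩
      rwa [← card_eq_of_reachable A (show ω ∈ (openConn b c : Set (BondConfig (Fin n))) from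
        (show (openGraph ω).Reachable o b from hωE).symm.trans hωF)]
    · rintro ⟨⟨hωE, hω⟩, hωF⟩
      refine ⟨⟨hωE, ?_⟩, hωF⟩
      rwa [card_eq_of_reachable A (show ω ∈ (openConn b c : Set (BondConfig (Fin n))) from
        (show (openGraph ω).Reachable o b from hωE).symm.trans hωF)]
  -- on `E` : `N = M_b`
  have h1 : (E ∩ Rb) \ F = E ∩ Fᶜ ∩ Ro := by
    ext ω
    simp only [mem_sdiff, mem_inter_iff, mem_compl_iff, hRb, hRo, mem_setOf_eq]
    constructor
    · rintro ⟨⟨hωE, hω⟩, hωF⟩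
      exact ⟨⟨hωE, hωF⟩, by rwa [card_eq_on_attached A hωE]⟩
    · rintro ⟨⟨hωE, hωF⟩, hω⟩
      exact ⟨⟨hωE, by rwa [← card_eq_on_attached A hωE]⟩, hωF⟩
  have h2 : (E ∩ Rc) \ F = E ∩ Fᶜ ∩ Rc := by
    ext ω
    simp only [mem_sdiff, mem_inter_iff, mem_compl_iff]
    tauto
  rw [hsb, hsc, hEF, h1, h2] at hT
  linarith

end AttachedShift

open AttachedShift AttachedChampionObserverExchange in
/-- **Two gates, attached form.**  Let `b, b' ∈ A` be relays with `μ(M_{b'} ≤ j) ≤ μ(M_b ≤ j)` such that every connection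
of the observer `o` to a relay passes through one of them as an event: `{o ↔ a} ⊆ {o ↔ b} ∪ {o ↔ b'}` for all `a ∈ A`
(e.g. the Steiner region of `o` has boundary relays `{b, b'}`).  Then `μ(1 ≤ N ≤ j) ≤ μ(M_b ≤ j ∧ 1 ≤ N)`, whatever the
champion is.  [two-cluster exchange of VandenbergHaggstromKahn2005, Thm. 1.5, via `attached_avoid_shift`] -/
theorem attached_le_of_twoGates (w : Sym2 (Fin n) → unitInterval) (A : Finset (Fin n)) (o b b' : Fin n) (j : ℕ)
    (hb : b ∈ A) (hb' : b' ∈ A)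
    (hgate : ∀ a ∈ A, (openConn o a : Set (BondConfig (Fin n))) ⊆ openConn o b ∪ openConn o b')
    (hle : (prodBernoulli w).real {ω : BondConfig (Fin n) | (A.filter fun x => ω ∈ openConn b' x).card ≤ j} ≤
      (prodBernoulli w).real {ω : BondConfig (Fin n) | (A.filter fun x => ω ∈ openConn b x).card ≤ j}) :
    (prodBernoulli w).real {ω : BondConfig (Fin n) |
        1 ≤ (A.filter fun x => ω ∈ openConn o x).card ∧ (A.filter fun x => ω ∈ openConn o x).card ≤ j} ≤
      (prodBernoulli w).real {ω : BondConfig (Fin n) |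
        (A.filter fun x => ω ∈ openConn b x).card ≤ j ∧ 1 ≤ (A.filter fun x => ω ∈ openConn o x).card} := by
  set μ := prodBernoulli w with hμ
  set E : Set (BondConfig (Fin n)) := openConn o b with hE
  set F : Set (BondConfig (Fin n)) := openConn o b' with hF
  set Rb : Set (BondConfig (Fin n)) := {ω | (A.filter fun x => ω ∈ openConn b x).card ≤ j} with hRb
  set Ro : Set (BondConfig (Fin n)) := {ω | (A.filter fun x => ω ∈ openConn o x).card ≤ j} with hRo
  have hmeas : ∀ s : Set (BondConfig (Fin n)), MeasurableSet s := fun _ => MeasurableSet.of_discrete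
  -- attachment: `1 ≤ N ↔ o ↔ b ∨ o ↔ b'`
  have hatt : ∀ ω : BondConfig (Fin n), 1 ≤ (A.filter fun x => ω ∈ openConn o x).card ↔ ω ∈ E ∪ F := by
    intro ω
    rw [Nat.one_le_iff_ne_zero, Ne, Finset.card_eq_zero, ← Ne, ← Finset.nonempty_iff_ne_empty,
      Finset.filter_nonempty_iff]
    constructor
    · rintro ⟨a, ha, hωa⟩
      exact hgate a ha hωa
    · intro h
      rcases h with h | h
      · exact ⟨b, hb, h⟩
      · exact ⟨b', hb', h⟩
  -- the two sides as disjoint unions along `E`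
  have hL : {ω : BondConfig (Fin n) | 1 ≤ (A.filter fun x => ω ∈ openConn o x).card ∧
      (A.filter fun x => ω ∈ openConn o x).card ≤ j} = (E ∩ Rb) ∪ (F ∩ Eᶜ ∩ Ro) := by
    ext ω
    simp only [mem_setOf_eq, mem_union, mem_inter_iff, mem_compl_iff, hatt ω, hRb, hRo]
    constructor
    · rintro ⟨hA, hN⟩
      by_cases hωE : ω ∈ E
      · exact Or.inl ⟨hωE, by rwa [← card_eq_on_attached A hωE]⟩
      · rcases hA with h | h
        · exact absurd h hωE
        · exact Or.inr ⟨⟨h, hωE⟩, hN⟩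
    · rintro (⟨hωE, hω⟩ | ⟨⟨hωF, hωE⟩, hN⟩)
      · exact ⟨Or.inl hωE, by rwa [card_eq_on_attached A hωE]⟩
      · exact ⟨Or.inr hωF, hN⟩
  have hT : {ω : BondConfig (Fin n) | (A.filter fun x => ω ∈ openConn b x).card ≤ j ∧
      1 ≤ (A.filter fun x => ω ∈ openConn o x).card} = (E ∩ Rb) ∪ (F ∩ Eᶜ ∩ Rb) := by
    ext ω
    simp only [mem_setOf_eq, mem_union, mem_inter_iff, mem_compl_iff, hatt ω, hRb]
    constructor
    · rintro ⟨hN, hA⟩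
      by_cases hωE : ω ∈ E
      · exact Or.inl ⟨hωE, hN⟩
      · rcases hA with h | h
        · exact absurd h hωE
        · exact Or.inr ⟨⟨h, hωE⟩, hN⟩
    · rintro (⟨hωE, hω⟩ | ⟨⟨hωF, hωE⟩, hN⟩)
      · exact ⟨hω, Or.inl hωE⟩
      · exact ⟨hN, Or.inr hωF⟩
  have hdisj1 : Disjoint (E ∩ Rb) (F ∩ Eᶜ ∩ Ro) := by
    rw [Set.disjoint_left]
    rintro ω ⟨hωE, -⟩ ⟨⟨-, hωE'⟩, -⟩
    exact hωE' hωE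
  have hdisj2 : Disjoint (E ∩ Rb) (F ∩ Eᶜ ∩ Rb) := by
    rw [Set.disjoint_left]
    rintro ω ⟨hωE, -⟩ ⟨⟨-, hωE'⟩, -⟩
    exact hωE' hωE
  rw [hL, hT, measureReal_union hdisj1 (hmeas _), measureReal_union hdisj2 (hmeas _)]
  have hshift := attached_avoid_shift w A o b' b j hle
  linarith

open AttachedShift in
/-- **CIL for every observer with at most two gates** — the registered stub `stub_cumulativeIsolation` of crux
`NoHeavyLowerTail` (stmt-CriticalPhenomena-4575) on this class: for any vertex `o`, if `b, b' ∈ A` and every connection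
`o ↔ a` (`a ∈ A`) passes through `b` or `b'`, then some relay `a ∈ A` has `μ(1 ≤ N ≤ j) ≤ μ(M_a ≤ j)` — namely the gate
that is more often light.  [two-cluster exchange of VandenbergHaggstromKahn2005, Thm. 1.5] -/
theorem cil_of_twoGates (w : Sym2 (Fin n) → unitInterval) (A : Finset (Fin n)) (o b b' : Fin n) (j : ℕ)
    (hb : b ∈ A) (hb' : b' ∈ A)
    (hgate : ∀ a ∈ A, (openConn o a : Set (BondConfig (Fin n))) ⊆ openConn o b ∪ openConn o b') :
    ∃ a ∈ A,
      (prodBernoulli w).real {ω : BondConfig (Fin n) |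
          1 ≤ (A.filter fun x => ω ∈ openConn o x).card ∧ (A.filter fun x => ω ∈ openConn o x).card ≤ j} ≤
        (prodBernoulli w).real {ω : BondConfig (Fin n) | (A.filter fun x => ω ∈ openConn a x).card ≤ j} := by
  rcases le_total
      ((prodBernoulli w).real {ω : BondConfig (Fin n) | (A.filter fun x => ω ∈ openConn b' x).card ≤ j})
      ((prodBernoulli w).real {ω : BondConfig (Fin n) | (A.filter fun x => ω ∈ openConn b x).card ≤ j}) with h | h
  · refine ⟨b, hb, (attached_le_of_twoGates w A o b b' j hb hb' hgate h).trans ?_⟩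
    exact measureReal_mono (fun ω hω => hω.1) (measure_ne_top _ _)
  · have hgate' : ∀ a ∈ A, (openConn o a : Set (BondConfig (Fin n))) ⊆ openConn o b' ∪ openConn o b :=
      fun a ha => (hgate a ha).trans (union_comm _ _).subset
    refine ⟨b', hb', (attached_le_of_twoGates w A o b' b j hb' hb hgate' h).trans ?_⟩
    exact measureReal_mono (fun ω hω => hω.1) (measure_ne_top _ _)

end Summit.CriticalPhenomena.PercolationContinuityZ3.Theorems

end
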